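import Summits.ResolutionOfSingularities.ResolutionOfSingularities.Theorems.MonomialBlowupLU2
import HarnessLib

/-!
# MonomialBlowupLU3 — THE CELL `MonomialBlowupAbove k O` and THE LAW `quasiFiniteLUAbove_of_monomialBlowupAbove` (+ the composite `relLU_of_monomialBlowupAbove` by name through the landed `relLU_of_quasiFiniteLUAbove`, `decompositionFieldLUAbove_of_monomialBlowupAbove`, `not_monomialBlowupAbove_of_not_decompositionFieldLUAbove`)

One of the four landing files of the g30 node «MonomialBlowup» of the ROOT/RESIDUAL decomposition cell `decomp-res`
(lens 1; Door B of NEXT-g30, critic rows 207 / 223 / 223c; files `MonomialBlowupLU`, `…LU2`, `…LU3`, `…LU4`); see the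
module docstring of `Summits.ResolutionOfSingularities.ResolutionOfSingularities.Theorems.MonomialBlowupLU` for the thesis ([CossartPiltant2008,
Prop. 9.3] LAYER 3 in every dimension), the cell `MonomialBlowupAbove k O` and the law
`quasiFiniteLUAbove_of_monomialBlowupAbove : MonomialBlowupAbove k O → QuasiFiniteLUAbove k O` (in `…LU3`), the
costume diff, the paper instance and the sources.  This file: PART B, summit frame (NAME and TYPE as pre-ruled in row 223c: `{O : ValuationSubring K} (h : MonomialBlowupAbove k O) : QuasiFiniteLUAbove k O`).
Imports: the landed `…MonomialBlowupLU2`.  Problem side, sorry-free, hypothesis-free (zero fact binders); every heavy theorem carries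
`set_option maxHeartbeats … in` BEFORE its docstring — keep it.
-/

noncomputable section

open IsLocalRing Polynomial IntermediateField Literature.AlgebraicGeometry.Resolution
open Summit.ResolutionOfSingularities.ResolutionOfSingularities.Theorems.DecompositionDescentLU
open scoped Pointwise

namespace Summit.ResolutionOfSingularities.ResolutionOfSingularities.Theorems.MonomialBlowupLU

universe u


/-! ## PART B (summit frame `k ⊆ K`, `O` a valuation ring of `K`) — THE CELL `MonomialBlowupAbove k O` and THE LAW
`MonomialBlowupAbove k O → QuasiFiniteLUAbove k O → RelLocalUniformization k K O` -/

section Law3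

variable {k K : Type} [Field k] [Field K] [Algebra k K]

variable (k)

/-- **THE CELL `MonomialBlowupAbove k O` — MONOMIAL BLOW-UP UPSTAIRS: the OUTPUT of [CossartPiltant2008, Prop. 8.1]
in a finite Hensel layer** (a typed syntactic sub-class of places `(K, O)` over `k`, everything read in `K̄`; new as
a kind: it is neither an «LU upstairs exists» cell nor the quasi-finite cell).  FRAME (= the frame of
`DecompositionDescentLU.QuasiFiniteLUAbove`): `O_E` above `O` with residues algebraic over `k`; a Hensel root
`η ∈ O_E` over `O` with `K`-rational residue; a layer `K ≤ K′ ≤ K(η)` (ARBITRARY degree `[K′ : K]`).  CLAUSE — for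
EVERY normal affine model `k[t₁] ⊆ O` of `K` (`t₁ ⊆ K`, `Frac k[t₁] = K`, `k[t₁]` integrally closed in `K`) and
EVERY presentation `k[t₁ ∪ t₁′]` (`t₁′ ⊆ K′`) of its integral closure in `K′` ("`R₁′` the unique normal local model
of `V′/k` lying above `R₁`", HAL p. 27), writing `R₁′ := k[t₁ ∪ t₁′]_𝔪` for its local ring at the centre of
`O_E`, THERE IS a model `k[t′] ⊇ k[t₁ ∪ t₁′]` of `K′` inside `O_E`, REGULAR at the centre, of SOME dimension `d`,
with a regular system of parameters `x₀, …, x_{d-1}` of `S′ := k[t′]_𝔪` (non-zero, spanning `𝔪_{S′}`) and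
`0 < r ≤ d`, such that:
(a) `𝔪_{R₁′}·S′ ⊆ (x₀ ⋯ x_{r-1})·S′` — [CoP1] Prop. 8.1 (2) "`√(f S) = √(𝔪_{S₀} S) = (x₁ ⋯ x_r)`" (HAL p. 21);
(b) there are `f₀, …, f_{r-1} ∈ K` with `fᵢ = γᵢ ∏_{j<r} xⱼ^{aᵢⱼ}`, `γᵢ ∈ S′×`, `det(aᵢⱼ) ≠ 0` — [CoP1] (46)
  "For each `i` … `fᵢ = γᵢ ∏ xⱼ^{aᵢⱼ}` where `γᵢ` is a unit in `S′` … the matrix `A := (aᵢⱼ)` is nonsingular"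
  (HAL p. 27; there `f₁, …, f_r ∈ R₁` is a rational basis of the value group, which forces `det A ≠ 0`);
(c) some `f ∈ R₁′`, a unit of `S′` times a monomial in `x₀, …, x_{r-1}`, with `t′ ⊆ R₁′[1/f]` — [CoP1] Prop. 8.1
  (1) "`R₁′ < S′` and `(R₁′)_f = S′_f`" with (2) "`√(f S′) = (x₁ ⋯ x_r)`" (HAL pp. 21, 27).
The number `d − r` of NON-exceptional parameters (the `Hⱼ`'s of (49)–(51)) is ARBITRARY.  This is, clause for
clause, the hypothesis `hHead` of the tree's `Literature.…exists_localUniformization_of_head'` (there: base a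
complete regular local ring `S` with `E | S` algebraic, `d = 3`), here over the FIELD `k` in the summit frame and in
EVERY dimension.  Producing it from a local uniformization of `(K′, O_E ∩ K′)` is [CoP1] Prop. 8.1 = Prop. 4.1
(embedded monomialization of an ideal in a regular threefold, HAL pp. 21–22) — dimension `3` in print, OPEN
(Hironaka-strength principalization upstairs) in dimension `≥ 4`: NOT claimed, it is the honest INPUT of this cell.
(Sources: CossartPiltant2008, Prop. 8.1 and proof of Prop. 9.3, (46)–(47) (HAL pp. 21–22, 27–28).) -/
def MonomialBlowupAbove (O : ValuationSubring K) : Prop :=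
  ∃ OE : ValuationSubring (AlgebraicClosure K), OE.comap (algebraMap K (AlgebraicClosure K)) = O ∧
  (∀ y ∈ OE, ∃ g : Polynomial k, g ≠ 0 ∧ OE.valuation (Polynomial.aeval y g) < 1) ∧
  ∃ η : AlgebraicClosure K, η ∈ OE ∧
    (∃ x : K, OE.valuation (η - algebraMap K (AlgebraicClosure K) x) < 1) ∧
    (∃ f : Polynomial K, (∀ i, f.coeff i ∈ O) ∧ Polynomial.aeval η f = 0 ∧
      OE.valuation (Polynomial.aeval η (Polynomial.derivative f)) = 1) ∧
  ∃ K' : IntermediateField K (AlgebraicClosure K), K' ≤ K⟮η⟯ ∧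
  ∀ (t₁ : Finset (AlgebraicClosure K)),
      (t₁ : Set (AlgebraicClosure K)) ⊆ (algebraMap K (AlgebraicClosure K)).fieldRange →
      (algebraMap K (AlgebraicClosure K)).fieldRange ≤
        Subfield.closure (Set.range (algebraMap k (AlgebraicClosure K)) ∪ (t₁ : Set (AlgebraicClosure K))) →
      (Algebra.adjoin k (t₁ : Set (AlgebraicClosure K))).toSubring ≤ OE.toSubring →
      (∀ x : AlgebraicClosure K, x ∈ (algebraMap K (AlgebraicClosure K)).fieldRange →
        IsIntegral (Algebra.adjoin k (t₁ : Set (AlgebraicClosure K))) x →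
        x ∈ Algebra.adjoin k (t₁ : Set (AlgebraicClosure K))) →
    ∀ (t₁' : Finset (AlgebraicClosure K)), (t₁' : Set (AlgebraicClosure K)) ⊆ (K' : Set (AlgebraicClosure K)) →
      (∀ x : AlgebraicClosure K, x ∈ K' →
        (IsIntegral (Algebra.adjoin k (t₁ : Set (AlgebraicClosure K))) x ↔
          x ∈ Algebra.adjoin k ((t₁ : Set (AlgebraicClosure K)) ∪ (t₁' : Set (AlgebraicClosure K))))) →
    ∃ (t' : Finset (AlgebraicClosure K)) (_ : (t' : Set (AlgebraicClosure K)) ⊆ (K' : Set (AlgebraicClosure K)))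
      (hTO' : (Algebra.adjoin k (t' : Set (AlgebraicClosure K))).toSubring ≤ OE.toSubring)
      (_ : Algebra.adjoin k ((t₁ : Set (AlgebraicClosure K)) ∪ (t₁' : Set (AlgebraicClosure K))) ≤
        Algebra.adjoin k (t' : Set (AlgebraicClosure K)))
      (_ : IsRegularLocalRing
        (locAtCentre (Algebra.adjoin k (t' : Set (AlgebraicClosure K))).toSubring OE))
      (d r : ℕ) (hr : r ≤ d) (_ : 0 < r)
      (x : Fin d → locAtCentre (Algebra.adjoin k (t' : Set (AlgebraicClosure K))).toSubring OE),
      (∀ j, ((x j : locAtCentre (Algebra.adjoin k (t' : Set (AlgebraicClosure K))).toSubring OE) :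
        AlgebraicClosure K) ≠ 0) ∧
      (haveI := isLocalRing_locAtCentre hTO'
       Ideal.span (Set.range x) =
         maximalIdeal (locAtCentre (Algebra.adjoin k (t' : Set (AlgebraicClosure K))).toSubring OE)) ∧
      (∀ y : locAtCentre (Algebra.adjoin k (t' : Set (AlgebraicClosure K))).toSubring OE,
        (y : AlgebraicClosure K) ∈ locAtCentre (Algebra.adjoin k
          ((t₁ : Set (AlgebraicClosure K)) ∪ (t₁' : Set (AlgebraicClosure K)))).toSubring OE →
        OE.valuation (y : AlgebraicClosure K) < 1 →
        y ∈ Ideal.span {∏ i : Fin r, x (Fin.castLE hr i)}) ∧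
      (∃ (f : Fin r → AlgebraicClosure K)
          (γ : Fin r → (locAtCentre (Algebra.adjoin k (t' : Set (AlgebraicClosure K))).toSubring OE)ˣ)
          (a : Matrix (Fin r) (Fin r) ℕ),
        (∀ i, f i ∈ (algebraMap K (AlgebraicClosure K)).fieldRange) ∧
        (∀ i, f i = ((γ i : locAtCentre (Algebra.adjoin k (t' : Set (AlgebraicClosure K))).toSubring OE) :
            AlgebraicClosure K) *
          ∏ j, ((x (Fin.castLE hr j) :
            locAtCentre (Algebra.adjoin k (t' : Set (AlgebraicClosure K))).toSubring OE) :
              AlgebraicClosure K) ^ a i j) ∧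
        (a.map (fun n : ℕ => (n : ℤ))).det ≠ 0) ∧
      (∃ (f₁ : AlgebraicClosure K)
          (w : (locAtCentre (Algebra.adjoin k (t' : Set (AlgebraicClosure K))).toSubring OE)ˣ)
          (e : Fin r → ℕ),
        f₁ ∈ locAtCentre (Algebra.adjoin k
          ((t₁ : Set (AlgebraicClosure K)) ∪ (t₁' : Set (AlgebraicClosure K)))).toSubring OE ∧
        f₁ = ((w : locAtCentre (Algebra.adjoin k (t' : Set (AlgebraicClosure K))).toSubring OE) :
            AlgebraicClosure K) *
          ∏ i, ((x (Fin.castLE hr i) :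
            locAtCentre (Algebra.adjoin k (t' : Set (AlgebraicClosure K))).toSubring OE) :
              AlgebraicClosure K) ^ e i ∧
        ∀ z ∈ (t' : Set (AlgebraicClosure K)), ∃ n : ℕ,
          f₁ ^ n * z ∈ locAtCentre (Algebra.adjoin k
            ((t₁ : Set (AlgebraicClosure K)) ∪ (t₁' : Set (AlgebraicClosure K)))).toSubring OE)

variable {k}

set_option maxHeartbeats 1600000 in
/-- **LAYER 3 ⟹ LAYER 2 (kernel, hypothesis-free): `MonomialBlowupAbove k O → QuasiFiniteLUAbove k O`.**  For each
model `R ⊆ O` of `K | k`, read its generators in `K̄` and run the layer-3 engine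
`exists_quasiFinite_of_monomialBlowup` (`E := K̄`, `M := K`, `K̄ | K` normal): the normal model `k[t₁] ⊇ R[c]`
(`c` the density constants), its integral closure in `K′`, the cell's monomial blow-up `S′` above it, (46)–(52)
in dimension `d`, and the quasi-finite regular model `k[t′, Fᵢ, Hⱼ]` of `K′` with `√((Fᵢ,Hⱼ)S′) = 𝔪_{S′}`,
`Fᵢ, Hⱼ ∈ K`. (Sources: CossartPiltant2008, proof of Prop. 9.3, (46)–(52) (HAL pp. 27–28).) -/
theorem quasiFiniteLUAbove_of_monomialBlowupAbove {O : ValuationSubring K}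
    (h : MonomialBlowupAbove k O) : QuasiFiniteLUAbove k O := by
  classical
  obtain ⟨OE, hOE, hres, η, hηO, ⟨x₀, hx₀⟩, ⟨f, hfO, hfη, hder⟩, K', hK'η, hHead⟩ := h
  refine ⟨OE, hOE, hres, η, hηO, ⟨x₀, hx₀⟩, ⟨f, hfO, hfη, hder⟩, K', hK'η,
    fun R hRfg hRfrac hRO => ?_⟩
  haveI := hRfrac
  let L := AlgebraicClosure K
  let ι : K →+* L := algebraMap K L
  let φ : K →ₐ[k] L := IsScalarTower.toAlgHom k K L
  have hmemO : ∀ x : K, x ∈ O ↔ ι x ∈ OE := fun x => by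
    rw [← hOE]; rfl
  let M : Subfield L := ι.fieldRange
  have hMmem : ∀ y : L, y ∈ M ↔ ∃ x : K, ι x = y := fun y => RingHom.mem_fieldRange
  have hιM : ∀ x : K, ι x ∈ M := fun x => (hMmem _).mpr ⟨x, rfl⟩
  have hkM : ∀ c : k, algebraMap k L c ∈ M := fun c => by
    rw [IsScalarTower.algebraMap_apply k K L]; exact hιM _
  have hkO : ∀ c : k, algebraMap k L c ∈ OE := fun c => by
    rw [IsScalarTower.algebraMap_apply k K L, ← hmemO]; exact hRO (R.algebraMap_mem c)
  -- `L | M` is normal (`L = K̄` is an algebraic closure of `M = K`)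
  haveI : Algebra.IsAlgebraic M L := by
    refine ⟨fun y => ?_⟩
    obtain ⟨p, hp0, hpy⟩ := (Algebra.IsAlgebraic.isAlgebraic (R := K) y)
    let e : K ≃+* M := ι.rangeRestrictFieldEquiv
    refine ⟨p.map (e : K →+* M), fun h0 => hp0 ?_, ?_⟩
    · exact (Polynomial.map_eq_zero_iff (e : K →+* M).injective).mp (by rw [h0])
    · rw [Polynomial.aeval_def, Polynomial.eval₂_map]
      have : (algebraMap M L).comp (e : K →+* M) = ι := by
        ext x; rfl
      rw [this]
      exact hpy
  haveI : IsAlgClosure M L := ⟨inferInstance, inferInstance⟩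
  haveI : Normal M L := IsAlgClosure.normal M L
  -- the Hensel root data read in `L`
  have hfM : ∀ i, (f.map ι).coeff i ∈ M := fun i => by
    rw [Polynomial.coeff_map]; exact hιM _
  have hfO' : ∀ i, (f.map ι).coeff i ∈ OE := fun i => by
    rw [Polynomial.coeff_map, ← hmemO]; exact hfO i
  have hfη' : (f.map ι).eval η = 0 := by
    rw [Polynomial.eval_map, ← Polynomial.aeval_def]; exact hfη
  have hder' : OE.valuation ((derivative (f.map ι)).eval η) = 1 := by
    rw [Polynomial.derivative_map, Polynomial.eval_map, ← Polynomial.aeval_def]; exact hder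
  -- `M ≤ K′ ≤ M(η)`
  have hMK' : M ≤ K'.toSubfield := fun y hy => by
    obtain ⟨x, rfl⟩ := (hMmem y).mp hy
    exact K'.algebraMap_mem x
  have hK'cl : K'.toSubfield ≤ Subfield.closure ((M : Set L) ∪ {η}) := by
    intro y hy
    have hy' : y ∈ (K⟮η⟯).toSubfield := hK'η hy
    rw [IntermediateField.adjoin_toSubfield] at hy'
    have hMe : Set.range (algebraMap K L) = (M : Set L) := (RingHom.coe_fieldRange ι).symm
    rw [hMe] at hy'
    exact hy'
  -- the generators of `R`, read in `L`
  obtain ⟨s₀, hs₀⟩ := hRfg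
  let s : Finset L := s₀.image ι
  have hRmap : R.map φ = Algebra.adjoin k (s : Set L) := by
    rw [← hs₀, AlgHom.map_adjoin, Finset.coe_image]; rfl
  have hsM : (s : Set L) ⊆ (M : Set L) := by
    intro z hz
    rw [Finset.mem_coe, Finset.mem_image] at hz
    obtain ⟨x, -, rfl⟩ := hz
    exact hιM x
  have hsO : ∀ z ∈ s, z ∈ OE := by
    intro z hz
    obtain ⟨x, hx, rfl⟩ := Finset.mem_image.mp hz
    rw [← hmemO]
    rw [← hs₀] at hRO
    exact hRO (Algebra.subset_adjoin hx)
  have hadj_cl : (Algebra.adjoin k (s : Set L) : Set L) ⊆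
      (Subfield.closure (Set.range (algebraMap k L) ∪ (s : Set L)) : Set L) := by
    intro z hz
    rw [SetLike.mem_coe, ← Subalgebra.mem_toSubring, Algebra.adjoin_eq_ring_closure] at hz
    exact Subring.closure_le.mpr (fun w hw => Subfield.subset_closure hw) hz
  have hMs : M ≤ Subfield.closure (Set.range (algebraMap k L) ∪ (s : Set L)) := by
    intro y hy
    obtain ⟨x, rfl⟩ := (hMmem y).mp hy
    obtain ⟨a, b, -, hab⟩ := IsFractionRing.div_surjective (A := R) x
    rw [← hab, map_div₀]
    have ha : ι a ∈ Algebra.adjoin k (s : Set L) := by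
      rw [← hRmap]; exact Subalgebra.mem_map.mpr ⟨a, a.2, rfl⟩
    have hb : ι b ∈ Algebra.adjoin k (s : Set L) := by
      rw [← hRmap]; exact Subalgebra.mem_map.mpr ⟨b, b.2, rfl⟩
    exact div_mem (hadj_cl ha) (hadj_cl hb)
  -- the engine
  obtain ⟨t, htK', hst, htO, hK't, hreg, F, hFM, hFt, hFv, hrad⟩ :=
    exists_quasiFinite_of_monomialBlowup OE k hkM hkO hηO (hιM x₀) hx₀ hfM hfO' hfη' hder'
      K'.toSubfield hMK' hK'cl s hsM hsO hMs
      (fun t₁ ht₁M hMcl ht₁O hnorm t₁' ht₁'K' hext => hHead t₁ ht₁M hMcl ht₁O hnorm t₁' ht₁'K' hext)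
  refine ⟨t, htK', ?_, htO, hK't, hreg, F, fun z hz => ?_, hFt, hFv, hrad⟩
  · rw [hRmap]; exact Algebra.adjoin_le hst
  · obtain ⟨x, hx⟩ := (hMmem z).mp (hFM hz)
    exact ⟨x, hx⟩

/-- **THE COMPOSITE LAW (kernel, hypothesis-free): `MonomialBlowupAbove k O → RelLocalUniformization k K O`** —
a monomial blow-up upstairs in a finite Hensel layer (the OUTPUT of [CoP1] Prop. 8.1, any degree, any dimension)
COMES DOWN: layer 3 (this file) ∘ layer 2 (`decompositionFieldLUAbove_of_quasiFiniteLUAbove`, ZMT) ∘ layer 1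
(`relLU_of_decompositionFieldLUAbove`, étale descent of regularity) — BY NAME through the landed
`relLU_of_quasiFiniteLUAbove`. (Sources: CossartPiltant2008, Prop. 9.3 (HAL pp. 26–28).) -/
theorem relLU_of_monomialBlowupAbove {O : ValuationSubring K} (h : MonomialBlowupAbove k O) :
    RelLocalUniformization k K O :=
  relLU_of_quasiFiniteLUAbove (quasiFiniteLUAbove_of_monomialBlowupAbove h)

/-- Layer 3 composed with layer 2 only: `MonomialBlowupAbove k O → DecompositionFieldLUAbove k O`. [folklore] -/
theorem decompositionFieldLUAbove_of_monomialBlowupAbove {O : ValuationSubring K}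
    (h : MonomialBlowupAbove k O) : DecompositionFieldLUAbove k O :=
  decompositionFieldLUAbove_of_quasiFiniteLUAbove (quasiFiniteLUAbove_of_monomialBlowupAbove h)

/-- Off the decomposition-descent cell one is off the monomial-blow-up cell (contrapositive of layers 3 + 2): every
located residual since R27 carries `¬ MonomialBlowupAbove` for free. [folklore] -/
theorem not_monomialBlowupAbove_of_not_decompositionFieldLUAbove {O : ValuationSubring K}
    (h : ¬ DecompositionFieldLUAbove k O) : ¬ MonomialBlowupAbove k O :=
  fun hm => h (decompositionFieldLUAbove_of_monomialBlowupAbove hm)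

end Law3

end Summit.ResolutionOfSingularities.ResolutionOfSingularities.Theorems.MonomialBlowupLU

end
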